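/-
Origin: expansion seat `prover-pub-hodgecm-mc-sinst-1-g5-0`, handover #1227 2026-08-20T11:21Z md5 f35535e57f44 (105 l., 5 decls: 1 abbrev + 4 theorems) NEW additive leaf, ns HodgeCM.Model.SInstance; imports RUN-45 #1216 ThetaAdelicSideR1 + #1226 (this kit); ROWDEPS #1223 #1224 #1225 #1226; OPTIONAL row (defer to RUN 51 at packager's discretion); the (J-μ)-closed row-5 pin SROGTCJ (no PROVE input) + rfl/readback lemmas; NAME LIST: HodgeCM.Model.SInstance.SROGTCJ_eq · HodgeCM.Model.SInstance.hT_ROGTCJ · HodgeCM.Model.SInstance.SROGTCJ_eq_archSideOfT (`HOME/mc/pub-hodgecm-mc-sinst-1-g5/stage/HodgeCM/Model/ThetaAdelicSideR1J.lean`, md5 f35535e57f44, 105 lines);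
landed by the second packager p2 gen 7 (p2-g7) in gate run 50 as `HodgeCM/Model/ThetaAdelicSideR1J.lean` (verbatim).
-/
/-
Origin: CONSTRUCTION seat `prover-pub-hodgecm-mc-sinst-1-g5-0` (unit pub-hodgecm-mc-sinst-1-g5, gen 5 of mc-sinst-1 — S-INSTANCE CONSTRUCTOR,
BINDER-OWNERS row 5 `S`), 2026-08-20.  KERNEL only: 1 abbrev + theorems; closure {propext, Classical.choice, Quot.sound}.  Additive leaf over
#1216 `ThetaAdelicSideR1` (the pin `SROGTC`) and #1226 `ArchConjSlotVT` (the (J-μ)₂₃ identities as theorems); nothing of PerL ∕ QW8 is claimed.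
-/
import Summits.HodgeConjecture.HodgeCM.Model.ThetaAdelicSideR1
import Summits.HodgeConjecture.HodgeCM.Model.ArchConjSlotVT

/-!
# (J-μ) CLOSED: the row-5 pin with NO PROVE input — `SInstance.SROGTCJ`

`SROGTC @hGR @hGR₀ @hGR₁ @hGR₂ @hGR₃ @μ hΔ₁ hΔ₂ hΔ₃` (#1216) takes E's `μ` table and the three guarded (J-μ) identities.  At theta-3's
constructed table `μ♯♯ := ArchSideTerm.muSharp₂₃ μ` (RUN-48 (K10)) all three identities are KERNEL THEOREMS: `hΔ₁_GOG_muSharp₂₃` ((TD), (K10)) and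
`hΔ₂_GOG_muSharp₂₃_holds` ∕ `hΔ₃_GOG_muSharp₂₃_holds` (#1226, from (STRIP) period-1 #P48a + (VT) #1224/#1225 + (K10)).  This leaf names the
resulting pin

* **`SROGTCJ @hGR @hGR₀ @hGR₁ @hGR₂ @hGR₃ @μ : ∀ V c, ThetaAdelicSide V c`** — inputs: the five [GR91 3.1.1] splitting families (CITE) and the free
  integer table `μ` (DATA) ONLY; `SROGTCJ_eq` (rfl: it IS `SROGTC` at `μ♯♯` and the three theorems), rows `hLF` ∕ 13 hypothesis-free
  (`hLF_ROGTCJ`, `hT_ROGTCJ`), and `SROGTCJ_eq_archSideOfT` (under `GOG V c` the pin is period-1's twisted term at `η := EtaChi.η χVR (χWR μ♯♯)`).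

E children may write `SInstance.SROGTCJ @hGR @hGR₀ @hGR₁ @hGR₂ @hGR₃ @μ` for the pin blob
`SInstance.SROGTC @hGR … (ArchSideTerm.muSharp₂₃ @μ) (ArchSideTerm.hΔ₁_GOG_muSharp₂₃ …) (ArchSideTerm.hΔ₂_GOG_muSharp₂₃ … (hSV_holds @hGR)) (…)` of
#397J/#398J — the two are definitionally equal (`SROGTCJ_eq`, and `hΔ₂_GOG_muSharp₂₃_holds = hΔ₂_GOG_muSharp₂₃ … (hSV_holds hGR)` by `rfl`).
-/

set_option autoImplicit false

noncomputable section

open scoped Matrix Classical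
open Literature.NumberTheory.Automorphic Literature.NumberTheory.Weil1964
open Literature.NumberTheory.GelbartRogawski1991.UnitaryDualPair
open HodgeCM.Adelic HodgeCM.PerL34
open Literature.Geometry.ComplexHyperbolic.BallModel (U21 x₀ stabilizerEquivK21)
open Literature.NumberTheory.Automorphic.U21 (matA sclD)

namespace HodgeCM.Model.SInstance

open HodgeCM.Model.ArchSideTerm

variable
  (hGR : ∀ {L : CMField} {ι₁ : L →+* ℂ} (V : HermSpace3 L ι₁) (c : SeesawCtx L),
    (cmSplittingDatum (L : Type) finProdFinEquiv (frameD V) (frameD_real V) (frameD_ne V) (dW c.D) (dW_real c.D)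
      (dW_ne c.D)).CompatibleSplitting)
  (hGR₀ : ∀ {L : CMField} {ι₁ : L →+* ℂ} (V : HermSpace3 L ι₁) (c : SeesawCtx L),
    (cmSplittingDatum (L : Type) (e₁) (frameD V) (frameD_real V) (frameD_ne V) (lineVec (L : Type) (dW c.D 0))
      (fun _ => dW_real c.D 0) (fun _ => dW_ne c.D 0)).CompatibleSplitting)
  (hGR₁ : ∀ {L : CMField} {ι₁ : L →+* ℂ} (V : HermSpace3 L ι₁) (c : SeesawCtx L),
    (cmSplittingDatum (L : Type) (e₁) (frameD V) (frameD_real V) (frameD_ne V) (lineVec (L : Type) (dW c.D 1))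
      (fun _ => dW_real c.D 1) (fun _ => dW_ne c.D 1)).CompatibleSplitting)
  (hGR₂ : ∀ {L : CMField} {ι₁ : L →+* ℂ} (V : HermSpace3 L ι₁) (c : SeesawCtx L),
    (cmSplittingDatum (L : Type) (e₁) (frameD V) (frameD_real V) (frameD_ne V) (lineVec (L : Type) (dW' c.D 0))
      (fun _ => dW'_real c.D 0) (fun _ => dW'_ne c.D 0)).CompatibleSplitting)
  (hGR₃ : ∀ {L : CMField} {ι₁ : L →+* ℂ} (V : HermSpace3 L ι₁) (c : SeesawCtx L),
    (cmSplittingDatum (L : Type) (e₁) (frameD V) (frameD_real V) (frameD_ne V) (lineVec (L : Type) (dW' c.D 1))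
      (fun _ => dW'_real c.D 1) (fun _ => dW'_ne c.D 1)).CompatibleSplitting)
  (μ : ∀ {L : CMField}, SeesawCtx L → Fin 4 → NumberField.InfinitePlace (L : Type) → ℤ)

/-! ## the (J-μ)-closed pin -/

/-- **THE ROW-5 PIN WITH NO PROVE INPUT**: `SROGTC` at `μ♯♯ := ArchSideTerm.muSharp₂₃ μ` with the three guarded (J-μ) identities supplied by the
kernel theorems `hΔ₁_GOG_muSharp₂₃` (K10) and `hΔ₂/hΔ₃_GOG_muSharp₂₃_holds` (#1226); inputs hGR×5 (CITE [GR91 3.1.1]) and `μ` (DATA) only. -/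
abbrev SROGTCJ : ∀ {L : CMField} {ι₁ : L →+* ℂ} (V : HermSpace3 L ι₁) (c : SeesawCtx L), ThetaAdelicSide V c :=
  SROGTC @hGR @hGR₀ @hGR₁ @hGR₂ @hGR₃ (ArchSideTerm.muSharp₂₃ @μ)
    (ArchSideTerm.hΔ₁_GOG_muSharp₂₃ @hGR @hGR₀ @hGR₁ @hGR₂ @hGR₃ @μ)
    (ArchSideTerm.hΔ₂_GOG_muSharp₂₃_holds @hGR @hGR₀ @hGR₁ @hGR₂ @hGR₃ @μ)
    (ArchSideTerm.hΔ₃_GOG_muSharp₂₃_holds @hGR @hGR₀ @hGR₁ @hGR₂ @hGR₃ @μ)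

/-- `SROGTCJ` IS `SROGTC` at `μ♯♯` and the three (J-μ) theorems, the latter spelled through (K10)'s socket `hΔ₂/hΔ₃_GOG_muSharp₂₃ … (hSV_holds hGR)`
exactly as glue-1's #397J/#398J write the pin (definitional). -/
theorem SROGTCJ_eq {L : CMField} {ι₁ : L →+* ℂ} (V : HermSpace3 L ι₁) (c : SeesawCtx L) :
    SROGTCJ @hGR @hGR₀ @hGR₁ @hGR₂ @hGR₃ @μ V c =
      SROGTC @hGR @hGR₀ @hGR₁ @hGR₂ @hGR₃ (ArchSideTerm.muSharp₂₃ @μ)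
        (ArchSideTerm.hΔ₁_GOG_muSharp₂₃ @hGR @hGR₀ @hGR₁ @hGR₂ @hGR₃ @μ)
        (ArchSideTerm.hΔ₂_GOG_muSharp₂₃ @hGR @hGR₀ @hGR₁ @hGR₂ @hGR₃ @μ (ArchSideTerm.hSV_holds @hGR))
        (ArchSideTerm.hΔ₃_GOG_muSharp₂₃ @hGR @hGR₀ @hGR₁ @hGR₂ @hGR₃ @μ (ArchSideTerm.hSV_holds @hGR)) V c :=
  rfl

/-- **row 13 `hT` at the (J-μ)-closed pin, hypothesis-free.** -/
theorem hT_ROGTCJ : ∀ {L : CMField} {ι₁ : L →+* ℂ} (V : HermSpace3 L ι₁) (c : SeesawCtx L) (k : Fin 4) (N : ℕ),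
    ((SROGTCJ @hGR @hGR₀ @hGR₁ @hGR₂ @hGR₃ @μ V c).P k).IsThetaArchContinuous N :=
  hT_ROGTC @hGR @hGR₀ @hGR₁ @hGR₂ @hGR₃ (ArchSideTerm.muSharp₂₃ @μ) _ _ _

/-- `hLF` at the (J-μ)-closed pin, hypothesis-free. -/
theorem hLF_ROGTCJ : ∀ {L : CMField} {ι₁ : L →+* ℂ} (V : HermSpace3 L ι₁) (c : SeesawCtx L) (k : Fin 4),
    ((SROGTCJ @hGR @hGR₀ @hGR₁ @hGR₂ @hGR₃ @μ V c).P k).IsLFAction :=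
  hLF_ROGTC @hGR @hGR₀ @hGR₁ @hGR₂ @hGR₃ (ArchSideTerm.muSharp₂₃ @μ) _ _ _

/-- **under the OG guard the (J-μ)-closed pin IS period-1's twisted term** at `η := EtaChi.η χVR (χWR μ♯♯)`, `ν := νR V c`, `h₁W := hG_GOG V c hc`
and the transported read-off inputs `ART` at `μ♯♯` (= `SROGTC_eq_archSideOfT` at the three theorems). -/
theorem SROGTCJ_eq_archSideOfT {L : CMField} {ι₁ : L →+* ℂ} (V : HermSpace3 L ι₁) (c : SeesawCtx L) (hc : GOG V c) :
    SROGTCJ @hGR @hGR₀ @hGR₁ @hGR₂ @hGR₃ @μ V c =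
      archSideOfT V c (hGR V c) (hGR₀ V c) (hGR₁ V c) (hGR₂ V c) (hGR₃ V c)
        (EtaChi.η (@χVR @hGR @hGR₀ @hGR₁) (@χWR @hGR @hGR₀ @hGR₁ (ArchSideTerm.muSharp₂₃ @μ)) V c)
        (EtaChi.hη (@χVR @hGR @hGR₀ @hGR₁) (@χWR @hGR @hGR₀ @hGR₁ (ArchSideTerm.muSharp₂₃ @μ)) V c)
        (EtaChi.hηc (@χVR @hGR @hGR₀ @hGR₁) (@χWR @hGR @hGR₀ @hGR₁ (ArchSideTerm.muSharp₂₃ @μ)) V c)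
        (νR @hGR₁ V c) (hνR @hGR₁ V c) (hνcR @hGR₁ V c) (hG_GOG V c hc)
        (ART @GOG @hG_GOG @hGR @(@χVR @hGR @hGR₀ @hGR₁) @(@νR @hGR₁) @hGR₀ @hGR₁ @hGR₂ @hGR₃ (ArchSideTerm.muSharp₂₃ @μ) @hpos_GOG
          (ArchSideTerm.hΔ₁_GOG_muSharp₂₃ @hGR @hGR₀ @hGR₁ @hGR₂ @hGR₃ @μ)
          (ArchSideTerm.hΔ₂_GOG_muSharp₂₃_holds @hGR @hGR₀ @hGR₁ @hGR₂ @hGR₃ @μ)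
          (ArchSideTerm.hΔ₃_GOG_muSharp₂₃_holds @hGR @hGR₀ @hGR₁ @hGR₂ @hGR₃ @μ) V c hc) :=
  SROGTC_eq_archSideOfT @hGR @hGR₀ @hGR₁ @hGR₂ @hGR₃ (ArchSideTerm.muSharp₂₃ @μ) _ _ _ V c hc


end HodgeCM.Model.SInstance
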